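import Literature.Geometry.Riemannian.BakryEmeryHeatFlow
import Literature.Geometry.Riemannian.EigenvaluePinchingSphereProofs
import Literature.Geometry.Riemannian.RicciFlowScalarCurvatureComparison
import HarnessLib

/-!
# The dimensional dissipation of the Fisher information along the weighted heat flow
(stub `stub_dimensionalFisher` (B1) of line `curvature-dimension-entropy-floor`, crux
`EntropyRung.SubcylindricalExistence`, item stmt-SmoothPoincare4-10871)

Let `g` be Riemannian (Levi-Civita connection) on a manifold modelled on `E`, `n = finrank ℝ E`,
`V` a smooth weight with `Ric + Hess V ≥ K g`, `L = Δ_g − g⁻¹(dV, d·)`, `dm = e^{-V} dV_g`, and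
`f : ℝ → M → ℝ` smooth on `M × S` with `∂ₜf = Lf − |∇f|²` (the equation of `−log u` for a positive
solution of `∂ₜu = Lu`). The tree's `fisher_pointwise_le` / `integral_derivWithin_fisher_le`
(`Literature/Geometry/Riemannian/BakryEmeryHeatFlow.lean`; Carrillo–Ni 2009, §3, p. 8) read the
coordinate identity `MetricCoord.IsMetricOn.fisher_identity`
`∂ₜ|∇f|² − L|∇f|² + 2⟨∇f, ∇|∇f|²⟩ = −2|Hess f|² − 2(Ric + Hess V)(∇f, ∇f)` in the chart at a point
and DROP `|Hess f|² ≥ 0`. Here the dimensional information `|Hess f|²_g ≥ (Δ_g f)²/n`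
(Cauchy–Schwarz for the metric contraction, `trace_sq_div_finrank_le_normSq`; `Δ_g = tr_g Hess`)
is KEPT — the `CD(K, n)` form of the Bakry–Émery computation behind the entropy–energy
inequality `EE(K, n)` of the line:

* `fisher_pointwise_le_dim` (any model) —
  `∂ₜ|∇f|² ≤ L|∇f|² − 2 g⁻¹(df, d|∇f|²) − 2K|∇f|² − (2/n)(Δ_g f)²`;
* `integral_le_of_green_cancellation` — the measure-theoretic bookkeeping of the integration;
* `stub_dimensionalFisher` — **the registered stub** (closed four-manifolds of the summit binder,
  `S = [0, ∞)`, `n = finrank ℝ ℝ⁴ = 4`):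
  `∫ ∂ₜ(|∇f|² e^{-f}) dm ≤ −2K ∫ |∇f|² e^{-f} dm − ½ ∫ (Δ_g f)² e^{-f} dm`, the integration of
  the pointwise inequality, in which the `L`- and gradient terms cancel by the weighted Green
  identities verbatim as in `integral_derivWithin_fisher_le`.

Everything is proved; no definition, no named fact.

References: J. A. Carrillo, L. Ni, Comm. Anal. Geom. 17 (2009) 721–753 (arXiv:0806.2417), §3,
p. 8 [CarrilloNi2009]; D. Bakry, M. Émery, LNM 1123 (1985) 177–206 [BakryEmery1985]; D. Bakry,
I. Gentil, M. Ledoux, *Analysis and geometry of Markov diffusion operators* (2014), §6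
[BakryGentilLedoux2014]; P. Topping, *Lectures on the Ricci flow* (2006), Cor. 2.5.5 [Topping2006].
-/

noncomputable section

-- the registered namespace `Summit.SmoothPoincare4.SmoothPoincare4.Theorems` repeats a component
set_option linter.dupNamespace false

open Bundle Set Function Filter Module MeasureTheory
open scoped Manifold ContDiff Topology

namespace Summit.SmoothPoincare4.SmoothPoincare4.Theorems

open Literature.Geometry Literature.Geometry.Lorentzian Literature.Geometry.Riemannian
  Literature.Geometry.Lorentzian.PseudoRiemannianMetric

section Pointwise

variable {E : Type*} [NormedAddCommGroup E] [NormedSpace ℝ E] [FiniteDimensional ℝ E]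
  {H : Type*} [TopologicalSpace H] {I : ModelWithCorners ℝ E H} [I.Boundaryless]
  {M : Type*} [TopologicalSpace M] [ChartedSpace H M] [IsManifold I ∞ M]
  (g : PseudoRiemannianMetric I ∞ E (TangentSpace I : M → Type _)) [g.HasLeviCivita]

/-- **The dimensional pointwise dissipation inequality of the Bakry–Émery strategy** (any model,
`n = finrank ℝ E`): for `g` Riemannian with `Ric + Hess V ≥ K g`, `f` smooth on `M × S`
(`S` with unique derivatives, `S ⊆ closure (interior S)`) solving `∂ₜf = Lf − |∇f|²` on `M` at
each time of `S`, at every `x` and `t ∈ S`: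
`∂ₜ|∇f|² ≤ L|∇f|² − 2 g⁻¹(df, d|∇f|²) − 2K|∇f|² − (2/n)(Δ_g f)²`. Proof: the proof of
`fisher_pointwise_le` (chart at `x`, `MetricCoord.IsMetricOn.fisher_identity`,
`gradSq_chartInv_eq`, `dalembertian_chartInv_eq`, `innerDual_chartInv_eq`,
`bakryEmery_chartInv_le`) with `|Hess f|²` read back on the manifold
(`normSq_hessian_chartInv_eq`) and bounded below by `(Δ_g f)²/n`
(`trace_sq_div_finrank_le_normSq`) instead of `0`. [cite: CarrilloNi2009, §3 (p. 8)] -/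
theorem fisher_pointwise_le_dim (hR : g.IsRiemannian) {V : M → ℝ} {K : ℝ}
    (hV : ContMDiff I 𝓘(ℝ, ℝ) ∞ V)
    (hRic : ∀ (y : M) (X : TangentSpace I y), K * g.val y X X ≤ g.ricci y X X + g.hessian V y X X)
    {f : ℝ → M → ℝ} {S : Set ℝ} (hS : UniqueDiffOn ℝ S) (hS' : S ⊆ closure (interior S))
    (hf : ContMDiffOn (I.prod 𝓘(ℝ, ℝ)) 𝓘(ℝ, ℝ) ∞ (fun p : M × ℝ ↦ f p.2 p.1) (univ ×ˢ S))
    (heq : ∀ t ∈ S, ∀ y : M, derivWithin (fun s ↦ f s y) S t = g.dalembertian (f t) y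
      - g.innerDual y (mvfderiv I V y).toLinearMap (mvfderiv I (f t) y).toLinearMap
      - g.gradSq (f t) y)
    (x : M) {t : ℝ} (ht : t ∈ S) :
    derivWithin (fun s ↦ g.gradSq (f s) x) S t ≤
      (g.dalembertian (g.gradSq (f t)) x
        - g.innerDual x (mvfderiv I V x).toLinearMap (mvfderiv I (g.gradSq (f t)) x).toLinearMap)
      - 2 * g.innerDual x (mvfderiv I (f t) x).toLinearMap
          (mvfderiv I (g.gradSq (f t)) x).toLinearMap
      - 2 * K * g.gradSq (f t) x - 2 / finrank ℝ E * g.dalembertian (f t) x ^ 2 := by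
  -- the chart at `x`, the components `G`, the representatives `F̂`, `V̂`
  set G := chartRep I (fun _ ↦ g) x 0 with hGdef
  have hGm : MetricCoord.IsMetricOn G (extChartAt I x).target :=
    Lorentzian.OpensChart.isMetricOn_repr (val_chartPullback_eq_chartRep (fun _ : ℝ ↦ g) x 0)
  set Fh : ℝ → E → ℝ := fun s z ↦ f s ((extChartAt I x).symm z) with hFhdef
  set Vh : E → ℝ := V ∘ (extChartAt I x).symm with hVhdef
  have hu₀ : extChartAt I x x ∈ (extChartAt I x).target := mem_extChartAt_target x
  set u₀ : chartTarget I x := ⟨extChartAt I x x, hu₀⟩ with hu₀def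
  have hΦu₀ : chartInv I x u₀ = x := extChartAt_to_inv x
  -- smoothness of the slices and representatives
  have hslice : ∀ s ∈ S, ContMDiff I 𝓘(ℝ, ℝ) ∞ (f s) := fun s hs ↦
    hf.comp_contMDiff (contMDiff_id.prodMk contMDiff_const) fun y ↦ ⟨mem_univ _, hs⟩
  have hFh : ContDiffOn ℝ ∞ (fun p : E × ℝ ↦ Fh p.2 p.1) ((extChartAt I x).target ×ˢ S) :=
    contDiffOn_time_chart hf x
  have hVh : ContDiffOn ℝ ∞ Vh (extChartAt I x).target := by
    rw [hVhdef, ← contMDiffOn_iff_contDiffOn]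
    exact hV.comp_contMDiffOn (contMDiffOn_extChartAt_symm x)
  -- the equation read in the chart
  have heq' : ∀ z ∈ (extChartAt I x).target, MetricCoord.tDerivFun Fh S t z =
      MetricCoord.lapAt G (Fh t) z - fderiv ℝ (Fh t) z (MetricCoord.sharpAt G z (fderiv ℝ Vh z))
        - MetricCoord.gradSqAt G (Fh t) z := by
    intro z hz
    set u : chartTarget I x := ⟨z, hz⟩
    have hy := heq t ht (chartInv I x u)
    have hft2 : ContMDiffAt I 𝓘(ℝ, ℝ) 2 (f t) (chartInv I x u) :=
      ((hslice t ht).of_le (WithTop.coe_le_coe.mpr le_top)).contMDiffAt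
    have hftd : MDifferentiableAt I 𝓘(ℝ, ℝ) (f t) (chartInv I x u) :=
      (hslice t ht).mdifferentiableAt (by simp)
    have hVd : MDifferentiableAt I 𝓘(ℝ, ℝ) V (chartInv I x u) := hV.mdifferentiableAt (by simp)
    rw [dalembertian_chartInv_eq g x u hft2, innerDual_chartInv_eq g x u hVd hftd,
      gradSq_chartInv_eq g x u hftd] at hy
    rw [MetricCoord.tDerivFun, show (fun s ↦ Fh s z) = fun s ↦ f s (chartInv I x u) from rfl, hy,
      MetricCoord.apply_sharpAt_comm (hGm.isInvertible z hz) (hGm.symm z hz)]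
    rfl
  -- the coordinate identity at `(φ x, t)`
  have key := hGm.fisher_identity hS hS' hFh hVh hu₀ ht heq'
  -- transport of each term back to `x`
  have hft : ContMDiff I 𝓘(ℝ, ℝ) ∞ (f t) := hslice t ht
  have hftd : MDifferentiableAt I 𝓘(ℝ, ℝ) (f t) (chartInv I x u₀) :=
    hft.mdifferentiableAt (by simp)
  have hft2 : ContMDiffAt I 𝓘(ℝ, ℝ) 2 (f t) (chartInv I x u₀) :=
    (hft.of_le (WithTop.coe_le_coe.mpr le_top)).contMDiffAt
  have hVd : MDifferentiableAt I 𝓘(ℝ, ℝ) V (chartInv I x u₀) := hV.mdifferentiableAt (by simp)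
  have hV2 : ContMDiffAt I 𝓘(ℝ, ℝ) 2 V (chartInv I x u₀) :=
    (hV.of_le (WithTop.coe_le_coe.mpr le_top)).contMDiffAt
  have hQ : ContMDiff I 𝓘(ℝ, ℝ) ∞ (g.gradSq (f t)) := contMDiff_gradSq g hft
  have hQ2 : ContMDiffAt I 𝓘(ℝ, ℝ) 2 (g.gradSq (f t)) (chartInv I x u₀) :=
    (hQ.of_le (WithTop.coe_le_coe.mpr le_top)).contMDiffAt
  have hQd : MDifferentiableAt I 𝓘(ℝ, ℝ) (g.gradSq (f t)) (chartInv I x u₀) :=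
    hQ.mdifferentiableAt (by simp)
  -- (a) `|∇f_s|²(x) = gradSqAt G (F̂ s) (φ x)` for all `s ∈ S`, and near `φ x` at time `t`
  have hgrad : ∀ s ∈ S, g.gradSq (f s) x = MetricCoord.gradSqAt G (Fh s) (extChartAt I x x) := by
    intro s hs
    have h := gradSq_chartInv_eq g x u₀ (F := f s) ((hslice s hs).mdifferentiableAt (by simp))
    rwa [hΦu₀] at h
  have hQrep : (g.gradSq (f t) ∘ (extChartAt I x).symm) =ᶠ[𝓝 (extChartAt I x x)]
      MetricCoord.gradSqAt G (Fh t) := by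
    filter_upwards [(isOpen_extChartAt_target x).mem_nhds hu₀] with z hz
    exact gradSq_chartInv_eq g x ⟨z, hz⟩ (F := f t) (hft.mdifferentiableAt (by simp))
  -- (b) the Laplacian of `|∇f|²` and the two first-order terms
  have hlap : g.dalembertian (g.gradSq (f t)) x =
      MetricCoord.lapAt G (MetricCoord.gradSqAt G (Fh t)) (extChartAt I x x) := by
    have h := dalembertian_chartInv_eq g x u₀ hQ2
    rw [hΦu₀] at h
    rw [h]
    exact MetricCoord.lapAt_congr_of_eventuallyEq G hQrep
  have hIV : g.innerDual x (mvfderiv I V x).toLinearMap (mvfderiv I (g.gradSq (f t)) x).toLinearMap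
      = fderiv ℝ (MetricCoord.gradSqAt G (Fh t)) (extChartAt I x x)
        (MetricCoord.sharpAt G (extChartAt I x x) (fderiv ℝ Vh (extChartAt I x x))) := by
    have h := innerDual_chartInv_eq g x u₀ hVd hQd
    rw [hΦu₀] at h
    rw [h, MetricCoord.apply_sharpAt_comm (hGm.isInvertible _ hu₀) (hGm.symm _ hu₀),
      hQrep.fderiv_eq]
  have hIf : g.innerDual x (mvfderiv I (f t) x).toLinearMap
      (mvfderiv I (g.gradSq (f t)) x).toLinearMap
      = fderiv ℝ (MetricCoord.gradSqAt G (Fh t)) (extChartAt I x x)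
        (MetricCoord.sharpAt G (extChartAt I x x) (fderiv ℝ (Fh t) (extChartAt I x x))) := by
    have h := innerDual_chartInv_eq g x u₀ hftd hQd
    rw [hΦu₀] at h
    rw [h, MetricCoord.apply_sharpAt_comm (hGm.isInvertible _ hu₀) (hGm.symm _ hu₀),
      hQrep.fderiv_eq]
    rfl
  -- (c) the time derivative
  have hderiv : derivWithin (fun s ↦ g.gradSq (f s) x) S t =
      derivWithin (fun s ↦ MetricCoord.gradSqAt G (Fh s) (extChartAt I x x)) S t :=
    derivWithin_congr (fun s hs ↦ hgrad s hs) (hgrad t ht)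
  -- (d) the Hessian term, KEPT: `(Δ_g f)²/n ≤ |Hess f|²_g = normSqAt G (hessAt G F̂)` at `φ x`
  have hN : g.normSq x (g.hessian (f t) x) = MetricCoord.normSqAt G (extChartAt I x x)
      (MetricCoord.hessAt G (Fh t) (extChartAt I x x)) := by
    have h := normSq_hessian_chartInv_eq g x u₀ hft2
    rwa [hΦu₀] at h
  have hD : g.dalembertian (f t) x ^ 2 / finrank ℝ E ≤ MetricCoord.normSqAt G (extChartAt I x x)
      (MetricCoord.hessAt G (Fh t) (extChartAt I x x)) :=
    (g.trace_sq_div_finrank_le_normSq x hR (g.hessian (f t) x)).trans_eq hN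
  have h2 : 2 / finrank ℝ E * g.dalembertian (f t) x ^ 2 =
      2 * (g.dalembertian (f t) x ^ 2 / finrank ℝ E) := by
    ring
  -- (e) the Bakry–Émery tensor on `∇f`
  have hB := bakryEmery_chartInv_le g x u₀ hV2 (fun X ↦ hRic _ X)
    (MetricCoord.sharpAt G (extChartAt I x x) (fderiv ℝ (Fh t) (extChartAt I x x)))
  have hGX : G (extChartAt I x x)
      (MetricCoord.sharpAt G (extChartAt I x x) (fderiv ℝ (Fh t) (extChartAt I x x)))
      (MetricCoord.sharpAt G (extChartAt I x x) (fderiv ℝ (Fh t) (extChartAt I x x))) =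
      g.gradSq (f t) x := by
    rw [MetricCoord.apply_sharpAt_sharpAt (hGm.isInvertible _ hu₀), hgrad t ht]
    rfl
  have hB' : K * g.gradSq (f t) x ≤
      MetricCoord.ricAt G (extChartAt I x x)
          (MetricCoord.sharpAt G (extChartAt I x x) (fderiv ℝ (Fh t) (extChartAt I x x)))
          (MetricCoord.sharpAt G (extChartAt I x x) (fderiv ℝ (Fh t) (extChartAt I x x)))
        + MetricCoord.hessAt G Vh (extChartAt I x x)
          (MetricCoord.sharpAt G (extChartAt I x x) (fderiv ℝ (Fh t) (extChartAt I x x)))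
          (MetricCoord.sharpAt G (extChartAt I x x) (fderiv ℝ (Fh t) (extChartAt I x x))) := by
    rw [← hGX]
    exact hB
  rw [hderiv, hlap, hIV, hIf]
  linarith [key, hD, hB', h2]

end Pointwise

/-! ## Integration over a closed manifold -/

/-- **Bookkeeping for the integrated dissipation inequality** (pure measure theory): if
`D ≤ X₁ − 2X₂ − 2K X₃ − X₄ + X₅ − c Z` pointwise with all seven functions integrable, and
`∫ X₁ = ∫ X₅ − ∫ X₄`, `∫ X₁ = ∫ X₂` (on the manifold: the symmetry of the weighted Laplacian
with `L(e^{-f}) = e^{-f}(|∇f|² − Lf)`, resp. Green's identity with `d(e^{-f}) = −e^{-f} df`), then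
`∫ D ≤ −2K ∫ X₃ − c ∫ Z`. [folklore] -/
theorem integral_le_of_green_cancellation {α : Type*} [MeasurableSpace α] {μ : Measure α}
    {D X₁ X₂ X₃ X₄ X₅ Z : α → ℝ} {K c : ℝ} (hD : Integrable D μ) (h₁ : Integrable X₁ μ)
    (h₂ : Integrable X₂ μ) (h₃ : Integrable X₃ μ) (h₄ : Integrable X₄ μ) (h₅ : Integrable X₅ μ)
    (hZ : Integrable Z μ)
    (hle : ∀ y, D y ≤ X₁ y - 2 * X₂ y - 2 * K * X₃ y - X₄ y + X₅ y - c * Z y)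
    (e₁ : ∫ y, X₁ y ∂μ = ∫ y, X₅ y ∂μ - ∫ y, X₄ y ∂μ) (e₂ : ∫ y, X₁ y ∂μ = ∫ y, X₂ y ∂μ) :
    ∫ y, D y ∂μ ≤ -2 * K * ∫ y, X₃ y ∂μ - c * ∫ y, Z y ∂μ := by
  have i₂ : Integrable (fun y ↦ X₁ y - 2 * X₂ y) μ := h₁.sub (h₂.const_mul 2)
  have i₃ : Integrable (fun y ↦ X₁ y - 2 * X₂ y - 2 * K * X₃ y) μ := i₂.sub (h₃.const_mul _)
  have i₄ : Integrable (fun y ↦ X₁ y - 2 * X₂ y - 2 * K * X₃ y - X₄ y) μ := i₃.sub h₄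
  have i₅ : Integrable (fun y ↦ X₁ y - 2 * X₂ y - 2 * K * X₃ y - X₄ y + X₅ y) μ := i₄.add h₅
  have i₆ : Integrable (fun y ↦ X₁ y - 2 * X₂ y - 2 * K * X₃ y - X₄ y + X₅ y - c * Z y) μ :=
    i₅.sub (hZ.const_mul c)
  have hs : ∫ y, X₁ y - 2 * X₂ y - 2 * K * X₃ y - X₄ y + X₅ y - c * Z y ∂μ =
      ∫ y, X₁ y ∂μ - 2 * ∫ y, X₂ y ∂μ - 2 * K * ∫ y, X₃ y ∂μ - ∫ y, X₄ y ∂μ + ∫ y, X₅ y ∂μ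
        - c * ∫ y, Z y ∂μ := by
    rw [integral_sub i₅ (hZ.const_mul c), integral_add i₄ h₅, integral_sub i₃ h₄,
      integral_sub i₂ (h₃.const_mul _), integral_sub h₁ (h₂.const_mul 2), integral_const_mul,
      integral_const_mul, integral_const_mul]
  have hm := integral_mono hD i₆ hle
  linarith

/-- **STUB `stub_dimensionalFisher` (B1) of line `curvature-dimension-entropy-floor` — the
dimensional dissipation of the Fisher information on a closed Riemannian four-manifold**
(Carrillo–Ni 2009, §3, p. 8, with `−2|Hess f|² ≤ −½(Δf)²` kept). For `g` Riemannian (Levi-Civita)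
on a closed `4`-manifold, `V` smooth with `Ric + Hess V ≥ K g`, and `f` smooth on `M × [0, ∞)`
with `∂ₜf = Δf − g⁻¹(dV, df) − |∇f|²`: for every `t ≥ 0`,
`∫ ∂ₜ(|∇f|² e^{-f} e^{-V}) dV ≤ −2K ∫ |∇f|² e^{-f} e^{-V} dV − ½ ∫ (Δ_g f)² e^{-f} e^{-V} dV`.
Proof: pointwise `∂ₜ(|∇f|² e^{-f}) = (∂ₜ|∇f|²) e^{-f} − |∇f|² (∂ₜf) e^{-f}` is bounded by
`fisher_pointwise_le_dim` (`2 / finrank ℝ ℝ⁴ = 1/2`); after integration (all integrands are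
continuous on a compact manifold, `integrable_of_continuous`) the `L`- and gradient terms cancel
by `integral_mul_weightedLaplacian_comm` + `weightedLaplacian_exp_neg` and
`integral_mul_weightedLaplacian` + `mvfderiv_exp_neg_toLinearMap`, exactly as in the tree's
`integral_derivWithin_fisher_le` (`integral_le_of_green_cancellation`). The binder `_hg` (the
metric is Riemannian) is used. [cite: CarrilloNi2009, §3 (p. 8)] -/
theorem stub_dimensionalFisher :
    ∀ (M : Type) [TopologicalSpace M] [T2Space M] [SecondCountableTopology M]
      [ChartedSpace (EuclideanSpace ℝ (Fin 4)) M] [IsManifold (𝓡 4) ∞ M] [CompactSpace M]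
      [T3Space M] [MeasurableSpace M] [BorelSpace M]
      (g : PseudoRiemannianMetric (𝓡 4) ∞ (EuclideanSpace ℝ (Fin 4))
        (TangentSpace (𝓡 4) : M → Type _))
      [g.HasLeviCivita] (_hg : g.IsRiemannian) (V : M → ℝ) (K : ℝ), ContMDiff (𝓡 4) 𝓘(ℝ, ℝ) ∞ V →
      (∀ (y : M) (X : TangentSpace (𝓡 4) y), K * g.val y X X ≤ g.ricci y X X + g.hessian V y X X) →
      ∀ f : ℝ → M → ℝ,
        ContMDiffOn ((𝓡 4).prod 𝓘(ℝ, ℝ)) 𝓘(ℝ, ℝ) ∞ (fun p : M × ℝ ↦ f p.2 p.1) (univ ×ˢ Ici 0) →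
        (∀ t ∈ Ici (0 : ℝ), ∀ y : M, derivWithin (fun s ↦ f s y) (Ici 0) t =
          g.dalembertian (f t) y
            - g.innerDual y (mvfderiv (𝓡 4) V y : TangentSpace (𝓡 4) y →ₗ[ℝ] ℝ)
                (mvfderiv (𝓡 4) (f t) y : TangentSpace (𝓡 4) y →ₗ[ℝ] ℝ)
            - g.gradSq (f t) y) →
        ∀ t ∈ Ici (0 : ℝ),
          ∫ y, derivWithin (fun s ↦ g.gradSq (f s) y * Real.exp (-f s y) * Real.exp (-V y))
              (Ici 0) t ∂g.riemVolume ≤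
            -2 * K * ∫ y, g.gradSq (f t) y * Real.exp (-f t y) * Real.exp (-V y) ∂g.riemVolume
              - (1 / 2 : ℝ) * ∫ y, (g.dalembertian (f t) y) ^ 2 * Real.exp (-f t y)
                  * Real.exp (-V y) ∂g.riemVolume := by
  intro M _ _ _ _ _ _ _ _ _ g _ hR V K hV hRic f hf heq t ht
  have hS : UniqueDiffOn ℝ (Ici (0 : ℝ)) := uniqueDiffOn_Ici 0
  have hS' : Ici (0 : ℝ) ⊆ closure (interior (Ici (0 : ℝ))) := by rw [interior_Ici, closure_Ioi]
  have h4 : (2 : ℝ) / finrank ℝ (EuclideanSpace ℝ (Fin 4)) = 1 / 2 := by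
    rw [finrank_euclideanSpace_fin]
    norm_num
  -- the slice at time `t` and its regularity
  have hF : ContMDiff (𝓡 4) 𝓘(ℝ, ℝ) ∞ (f t) :=
    hf.comp_contMDiff (contMDiff_id.prodMk contMDiff_const) fun y ↦ ⟨mem_univ _, ht⟩
  have hF1 : ContMDiff (𝓡 4) 𝓘(ℝ, ℝ) 1 (f t) := hF.of_le (by norm_num)
  have hF2 : ContMDiff (𝓡 4) 𝓘(ℝ, ℝ) 2 (f t) := hF.of_le (WithTop.coe_le_coe.mpr le_top)
  have hQ : ContMDiff (𝓡 4) 𝓘(ℝ, ℝ) ∞ (g.gradSq (f t)) := contMDiff_gradSq g hF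
  have hQ1 : ContMDiff (𝓡 4) 𝓘(ℝ, ℝ) 1 (g.gradSq (f t)) := hQ.of_le (by norm_num)
  have hQ2 : ContMDiff (𝓡 4) 𝓘(ℝ, ℝ) 2 (g.gradSq (f t)) :=
    hQ.of_le (WithTop.coe_le_coe.mpr le_top)
  have hV1 : ContMDiff (𝓡 4) 𝓘(ℝ, ℝ) 1 V := hV.of_le (by norm_num)
  have hU : ContMDiff (𝓡 4) 𝓘(ℝ, ℝ) ∞ (fun y ↦ Real.exp (-f t y)) :=
    (Real.contDiff_exp.comp contDiff_neg).comp_contMDiff hF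
  have hU1 : ContMDiff (𝓡 4) 𝓘(ℝ, ℝ) 1 (fun y ↦ Real.exp (-f t y)) := hU.of_le (by norm_num)
  have hU2 : ContMDiff (𝓡 4) 𝓘(ℝ, ℝ) 2 (fun y ↦ Real.exp (-f t y)) :=
    hU.of_le (WithTop.coe_le_coe.mpr le_top)
  -- time derivatives within `[0, ∞)` at `t`, and the pointwise bound
  have hfd : ∀ y, HasDerivWithinAt (fun s ↦ f s y) (derivWithin (fun s ↦ f s y) (Ici 0) t)
      (Ici 0) t := fun y ↦ hasDerivWithinAt_time_of_contMDiffOn (by simp) hf y ht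
  have hqfam := contMDiffOn_gradSq_family g hS hf
  have hqd : ∀ y, HasDerivWithinAt (fun s ↦ g.gradSq (f s) y)
      (derivWithin (fun s ↦ g.gradSq (f s) y) (Ici 0) t) (Ici 0) t := fun y ↦
    hasDerivWithinAt_time_of_contMDiffOn (by simp) hqfam y ht
  have hpt := fisher_pointwise_le_dim g hR hV hRic hS hS' hf heq
  have hbound : ∀ y, derivWithin (fun s ↦ g.gradSq (f s) y * Real.exp (-f s y) * Real.exp (-V y))
      (Ici 0) t ≤
      Real.exp (-f t y) * (g.dalembertian (g.gradSq (f t)) y - g.innerDual y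
        (mvfderiv (𝓡 4) V y).toLinearMap (mvfderiv (𝓡 4) (g.gradSq (f t)) y).toLinearMap)
        * Real.exp (-V y)
      - 2 * (g.innerDual y (mvfderiv (𝓡 4) (f t) y).toLinearMap
          (mvfderiv (𝓡 4) (g.gradSq (f t)) y).toLinearMap * Real.exp (-f t y) * Real.exp (-V y))
      - 2 * K * (g.gradSq (f t) y * Real.exp (-f t y) * Real.exp (-V y))
      - g.gradSq (f t) y * (g.dalembertian (f t) y - g.innerDual y
          (mvfderiv (𝓡 4) V y).toLinearMap (mvfderiv (𝓡 4) (f t) y).toLinearMap)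
          * Real.exp (-f t y) * Real.exp (-V y)
      + g.gradSq (f t) y * g.gradSq (f t) y * Real.exp (-f t y) * Real.exp (-V y)
      - 1 / 2 * (g.dalembertian (f t) y ^ 2 * Real.exp (-f t y) * Real.exp (-V y)) := by
    intro y
    have hu : HasDerivWithinAt (fun s ↦ Real.exp (-f s y))
        (Real.exp (-f t y) * -(derivWithin (fun s ↦ f s y) (Ici 0) t)) (Ici 0) t :=
      ((hfd y).neg).exp
    rw [(((hqd y).fun_mul hu).mul_const (Real.exp (-V y))).derivWithin (hS t ht), heq t ht y]
    have h1 := hpt y ht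
    rw [h4] at h1
    have huw : 0 ≤ Real.exp (-f t y) * Real.exp (-V y) :=
      mul_nonneg (Real.exp_pos _).le (Real.exp_pos _).le
    nlinarith [mul_le_mul_of_nonneg_right h1 huw]
  -- continuity of everything (for integrability on the compact manifold)
  have hΔQc : Continuous (g.dalembertian (g.gradSq (f t))) := continuous_dalembertian g hQ2
  have hΔFc : Continuous (g.dalembertian (f t)) := continuous_dalembertian g hF2
  have hIVQ : Continuous fun y ↦ g.innerDual y (mvfderiv (𝓡 4) V y).toLinearMap
      (mvfderiv (𝓡 4) (g.gradSq (f t)) y).toLinearMap := continuous_innerDual_mvfderiv g hV1 hQ1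
  have hIFQ : Continuous fun y ↦ g.innerDual y (mvfderiv (𝓡 4) (f t) y).toLinearMap
      (mvfderiv (𝓡 4) (g.gradSq (f t)) y).toLinearMap := continuous_innerDual_mvfderiv g hF1 hQ1
  have hIVF : Continuous fun y ↦ g.innerDual y (mvfderiv (𝓡 4) V y).toLinearMap
      (mvfderiv (𝓡 4) (f t) y).toLinearMap := continuous_innerDual_mvfderiv g hV1 hF1
  have hQc : Continuous (g.gradSq (f t)) := hQ.continuous
  have hUc : Continuous fun y ↦ Real.exp (-f t y) := hU.continuous
  have hWc : Continuous fun y ↦ Real.exp (-V y) := Real.continuous_exp.comp hV.continuous.neg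
  -- the derivative family is smooth on `M × [0, ∞)`, hence its slice at `t` is continuous
  have hPfam : ContMDiffOn ((𝓡 4).prod 𝓘(ℝ, ℝ)) 𝓘(ℝ, ℝ) ∞
      (fun p : M × ℝ ↦ g.gradSq (f p.2) p.1 * Real.exp (-f p.2 p.1) * Real.exp (-V p.1))
      (univ ×ˢ Ici 0) :=
    (hqfam.mul ((Real.contDiff_exp.comp contDiff_neg).contMDiff.comp_contMDiffOn hf)).mul
      ((Real.contDiff_exp.comp contDiff_neg).comp_contMDiff (hV.comp contMDiff_fst)).contMDiffOn
  have hP'c : Continuous fun y ↦ derivWithin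
      (fun s ↦ g.gradSq (f s) y * Real.exp (-f s y) * Real.exp (-V y)) (Ici 0) t :=
    ((contMDiffOn_derivWithin_time_of_uniqueDiffOn
      (u := fun s y ↦ g.gradSq (f s) y * Real.exp (-f s y) * Real.exp (-V y)) hS
        hPfam).continuousOn.comp_continuous (continuous_id.prodMk continuous_const)
      fun y ↦ ⟨mem_univ _, ht⟩ :)
  -- integrate: the `L`- and gradient terms cancel (`integral_le_of_green_cancellation`)
  have i4 := g.integrable_of_continuous
    (((hQc.fun_mul (hΔFc.fun_sub hIVF)).fun_mul hUc).fun_mul hWc)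
  have i5 := g.integrable_of_continuous (((hQc.fun_mul hQc).fun_mul hUc).fun_mul hWc)
  refine integral_le_of_green_cancellation (g.integrable_of_continuous hP'c)
    (g.integrable_of_continuous ((hUc.fun_mul (hΔQc.fun_sub hIVQ)).fun_mul hWc))
    (g.integrable_of_continuous ((hIFQ.fun_mul hUc).fun_mul hWc))
    (g.integrable_of_continuous ((hQc.fun_mul hUc).fun_mul hWc)) i4 i5
    (g.integrable_of_continuous (((hΔFc.fun_pow 2).fun_mul hUc).fun_mul hWc)) hbound ?_ ?_
  · -- `∫ u (L|∇f|²) w = ∫ |∇f|² (L u) w = ∫ |∇f|⁴ u w − ∫ |∇f|² (Lf) u w`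
    rw [integral_mul_weightedLaplacian_comm g hR hU2 hQ2 hV1, ← integral_sub i5 i4]
    refine integral_congr_ae (Filter.Eventually.of_forall fun y ↦ ?_)
    dsimp only
    rw [weightedLaplacian_exp_neg g hF2.contMDiffAt]
    ring
  · -- `∫ u (L|∇f|²) w = −∫ g⁻¹(du, d|∇f|²) w = ∫ g⁻¹(df, d|∇f|²) u w`
    rw [integral_mul_weightedLaplacian g hR hU1 hQ2 hV1, ← integral_neg]
    refine integral_congr_ae (Filter.Eventually.of_forall fun y ↦ ?_)
    dsimp only
    rw [mvfderiv_exp_neg_toLinearMap (hF1.mdifferentiableAt one_ne_zero), g.innerDual_smul_left]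
    ring

end Summit.SmoothPoincare4.SmoothPoincare4.Theorems

end
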